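import Summits.ResolutionOfSingularities.ResolutionOfSingularities.Theorems.FrobeniusLadderFRationalResolutionVertexChartBlowupCharts
import Summits.ResolutionOfSingularities.ResolutionOfSingularities.Theorems.FrobeniusLadderFRationalResolutionVertexChartRegularity
import Summits.ResolutionOfSingularities.ResolutionOfSingularities.Theorems.FrobeniusLadderFRationalResolutionVertexChartSmallParameter
import HarnessLib

/-!
# Crux `FrobeniusLadder.FRationalResolution` (stmt-ResolutionOfSingularities-15317), line `redirect`,
# stub `stub_diagonalizableQuotientResolution` — **one round of the point-blow-up recursion at the ring
# level, II: the `v`-chart of the blow-up of the fixed point is regular off its new fixed point and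
# singular at it for `c ≥ 4`** (surface case over arbitrary fields; continues `…VertexChartBlowupCharts`,
# uses `…VertexChartRegularity`)

On `C_v = C[I/χ(v)]`, a vertex chart algebra over the ORIGINAL base with data `(v, x − v)` and parameter
`c − 2` (`…VertexChartBlowup.mem_blowupChartMonoid_v_iff`, `…VertexChartBlowupCharts.tower_pack`):

* **`isRegularLocalRing_vChart_of_not_mem`** — a prime over `𝔭` at which one of `χ_v(v)`, `χ_v(x − v)`,
  `χ_v(y′)` is a unit is regular;
* **`not_isRegularLocalRing_vChart_fixedPrime`** — for `c ≥ 4`, over a surface point of zero-dimensional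
  stratum, the prime over `𝔭` containing all `χ_v(q)`, `q ∉ L`, is not regular.

So the parameter drops by `2` per round and (`…VertexChartSmallParameter`) the recursion stops at `c ≤ 1`.
Honest label: assembly toward ONE leaf stub (no stub, crux or summit closed). No definitions, no named
facts, no sorry. [cite: Kato1994, (6.1), (10.1), (10.3)]
-/

noncomputable section

-- single-problem summit: the doubled namespace component is forced
set_option linter.dupNamespace false

open IsLocalRing Literature.AlgebraicGeometry.Resolution Literature.AlgebraicGeometry.Resolution.LogChart
  Literature.AlgebraicGeometry.Resolution.LogRefinedChart
open Summit.ResolutionOfSingularities.ResolutionOfSingularities.Theorems.FRationalResolution.ChartAlgebraTower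
open Summit.ResolutionOfSingularities.ResolutionOfSingularities.Theorems.FRationalResolution.VertexChartMonoid
open Summit.ResolutionOfSingularities.ResolutionOfSingularities.Theorems.FRationalResolution.VertexChartBlowup
open Summit.ResolutionOfSingularities.ResolutionOfSingularities.Theorems.FRationalResolution.VertexChartRegularity
open Summit.ResolutionOfSingularities.ResolutionOfSingularities.Theorems.FRationalResolution.VertexChartBlowupCharts
open Summit.ResolutionOfSingularities.ResolutionOfSingularities.Theorems.FRationalResolution.VertexChartSmallParameter

namespace Summit.ResolutionOfSingularities.ResolutionOfSingularities.Theorems.FRationalResolution.VertexChartBlowupStep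

universe u

variable {A : Type u} [CommRing A] [IsNoetherianRing A] {n : ℕ} {P : AddSubmonoid (Fin n → ℤ)}
  {φ : Multiplicative P →* A} {𝔭 : Ideal A} [𝔭.IsPrime] {C : Type u} [CommRing C] [Algebra A C]
  {Q : AddSubmonoid (Fin n → ℤ)} {χ : Multiplicative Q →* C} {v x : Fin n → ℤ} {c : ℕ}

/-! ### The chart at `v`: regular off the new fixed point, singular at it for `c ≥ 4` -/

/-- **The `v`-chart off its fixed point is regular.** On `C_v` (vertex chart with data `(v, x − v)`,
parameter `c − 2`), a prime over `𝔭` at which one of `χ_v(v)`, `χ_v(x − v)`, `χ_v(y − v)` is a unit is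
regular. [cite: Kato1994, (10.1), (10.3)] -/
theorem isRegularLocalRing_vChart_of_not_mem (hc : 2 ≤ c) (hP : P.FG)
    (hsat : ∀ (w : Fin n → ℤ) (k : ℕ), 0 < k → k • w ∈ P → w ∈ P)
    (hspanP : Submodule.span ℤ (P : Set (Fin n → ℤ)) = ⊤) (hPQ : P ≤ Q)
    (hχ : ∀ p : P, χ (Multiplicative.ofAdd ⟨(p : Fin n → ℤ), hPQ p.2⟩) =
      algebraMap A C (φ (Multiplicative.ofAdd p)))
    (hgen : Algebra.adjoin A (Set.range χ) = ⊤)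
    (hD : ∀ q ∈ Q, ∃ p ∈ P, q + p ∈ P)
    (hK : ∀ a : A, algebraMap A C a = 0 → ∃ p : P, φ (Multiplicative.ofAdd p) * a = 0)
    (hΩ : ∀ (K : Type u) [Field K] (g : A →+* K), (∀ p : P, g (φ (Multiplicative.ofAdd p)) ≠ 0) →
      ∃ ω : C →+* K, ω.comp (algebraMap A C) = g)
    (hQ : ∀ w, w ∈ Q ↔ ∃ g ∈ Submodule.span ℤ (faceMonoid P φ 𝔭 : Set (Fin n → ℤ)), ∃ m l : ℤ,
      0 ≤ m ∧ 0 ≤ m + (c : ℤ) * l ∧ w = g + m • v + l • x)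
    (hind : ∀ g ∈ Submodule.span ℤ (faceMonoid P φ 𝔭 : Set (Fin n → ℤ)), ∀ m l : ℤ,
      g + m • v + l • x = 0 → m = 0 ∧ l = 0)
    (hspan : ∀ w : Fin n → ℤ, ∃ g ∈ Submodule.span ℤ (faceMonoid P φ 𝔭 : Set (Fin n → ℤ)),
      ∃ m l : ℤ, w = g + m • v + l • x)
    (hreg : IsLogRegularAt P φ 𝔭) (hv : v ∈ Q)
    (𝔔 : Ideal (blowupAlgebra (Ideal.span ((fun q : Q => χ (Multiplicative.ofAdd q)) ''
        {q : Q | (q : Fin n → ℤ) = v ∨ (q : Fin n → ℤ) = x ∨ (q : Fin n → ℤ) = (c : ℤ) • v - x}))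
        (χ (Multiplicative.ofAdd ⟨v, hv⟩)))) [𝔔.IsPrime]
    (h𝔔 : 𝔔.comap (algebraMap A _) = 𝔭)
    (hv' : v ∈ blowupChartMonoid Q {q : Q | (q : Fin n → ℤ) = v ∨ (q : Fin n → ℤ) = x ∨
      (q : Fin n → ℤ) = (c : ℤ) • v - x} ⟨v, hv⟩)
    (hx' : x - v ∈ blowupChartMonoid Q {q : Q | (q : Fin n → ℤ) = v ∨ (q : Fin n → ℤ) = x ∨
      (q : Fin n → ℤ) = (c : ℤ) • v - x} ⟨v, hv⟩)
    (hy' : ((c - 2 : ℕ) : ℤ) • v - (x - v) ∈ blowupChartMonoid Q {q : Q | (q : Fin n → ℤ) = v ∨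
      (q : Fin n → ℤ) = x ∨ (q : Fin n → ℤ) = (c : ℤ) • v - x} ⟨v, hv⟩)
    (hunit : blowupChart Q χ {q : Q | (q : Fin n → ℤ) = v ∨ (q : Fin n → ℤ) = x ∨ (q : Fin n → ℤ) = (c : ℤ) • v - x} ⟨v, hv⟩ (Multiplicative.ofAdd ⟨v, hv'⟩) ∉ 𝔔 ∨
      blowupChart Q χ {q : Q | (q : Fin n → ℤ) = v ∨ (q : Fin n → ℤ) = x ∨ (q : Fin n → ℤ) = (c : ℤ) • v - x} ⟨v, hv⟩ (Multiplicative.ofAdd ⟨x - v, hx'⟩) ∉ 𝔔 ∨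
      blowupChart Q χ {q : Q | (q : Fin n → ℤ) = v ∨ (q : Fin n → ℤ) = x ∨ (q : Fin n → ℤ) = (c : ℤ) • v - x} ⟨v, hv⟩ (Multiplicative.ofAdd ⟨((c - 2 : ℕ) : ℤ) • v - (x - v), hy'⟩) ∉ 𝔔) :
    IsRegularLocalRing (Localization.AtPrime 𝔔) := by
  obtain ⟨hgen₂, hD₂, -, hΩ₂⟩ := tower_pack hPQ hχ hgen hD hK hΩ
    {q : Q | (q : Fin n → ℤ) = v ∨ (q : Fin n → ℤ) = x ∨ (q : Fin n → ℤ) = (c : ℤ) • v - x} ⟨v, hv⟩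
  have hχ₂ := tower_chi hPQ hχ (le_blowupChartMonoid Q {q : Q | (q : Fin n → ℤ) = v ∨ (q : Fin n → ℤ) = x ∨ (q : Fin n → ℤ) = (c : ℤ) • v - x} ⟨v, hv⟩) (blowupChart_of_mem Q χ {q : Q | (q : Fin n → ℤ) = v ∨ (q : Fin n → ℤ) = x ∨ (q : Fin n → ℤ) = (c : ℤ) • v - x} ⟨v, hv⟩)
  have hQ₂ := mem_blowupChartMonoid_v_iff hc hQ hind hv
  have hind₂ := vertexBlowup_independent (L := Submodule.span ℤ (faceMonoid P φ 𝔭 : Set (Fin n → ℤ)))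
    hind
  have hspan₂ : ∀ w : Fin n → ℤ, ∃ g ∈ Submodule.span ℤ (faceMonoid P φ 𝔭 : Set (Fin n → ℤ)),
      ∃ m l : ℤ, w = g + m • v + l • (x - v) := by
    intro w
    obtain ⟨g, hg, m, l, rfl⟩ := hspan w
    exact ⟨g, hg, m + l, l, by module⟩
  exact isRegularLocalRing_of_generator_not_mem hP hsat hspanP (hPQ.trans (le_blowupChartMonoid Q {q : Q | (q : Fin n → ℤ) = v ∨ (q : Fin n → ℤ) = x ∨ (q : Fin n → ℤ) = (c : ℤ) • v - x} ⟨v, hv⟩))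
    hχ₂ hgen₂ hΩ₂ hD₂ hQ₂ hind₂ hspan₂ 𝔔 h𝔔 hreg hv' hx' hy' hunit

/-- **The new fixed point is singular** (for `c ≥ 4`, over a surface point of zero-dimensional
stratum): on `C_v` the prime over `𝔭` containing all `χ_v(q)`, `q ∉ L`, is not regular.
[cite: Kato1994, (6.1), (10.1)] -/
theorem not_isRegularLocalRing_vChart_fixedPrime [IsNoetherianRing C] (hc : 4 ≤ c) (hP : P.FG)
    (hsat : ∀ (w : Fin n → ℤ) (k : ℕ), 0 < k → k • w ∈ P → w ∈ P)
    (hreg : IsLogRegularAt P φ 𝔭) (hPQ : P ≤ Q)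
    (hχ : ∀ p : P, χ (Multiplicative.ofAdd ⟨(p : Fin n → ℤ), hPQ p.2⟩) =
      algebraMap A C (φ (Multiplicative.ofAdd p)))
    (hgen : Algebra.adjoin A (Set.range χ) = ⊤)
    (hD : ∀ q ∈ Q, ∃ p ∈ P, q + p ∈ P)
    (hK : ∀ a : A, algebraMap A C a = 0 → ∃ p : P, φ (Multiplicative.ofAdd p) * a = 0)
    (hΩ : ∀ (K : Type u) [Field K] (g : A →+* K), (∀ p : P, g (φ (Multiplicative.ofAdd p)) ≠ 0) →
      ∃ ω : C →+* K, ω.comp (algebraMap A C) = g)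
    (hQfg : Q.FG)
    (hQ : ∀ w, w ∈ Q ↔ ∃ g ∈ Submodule.span ℤ (faceMonoid P φ 𝔭 : Set (Fin n → ℤ)), ∃ m l : ℤ,
      0 ≤ m ∧ 0 ≤ m + (c : ℤ) * l ∧ w = g + m • v + l • x)
    (hind : ∀ g ∈ Submodule.span ℤ (faceMonoid P φ 𝔭 : Set (Fin n → ℤ)), ∀ m l : ℤ,
      g + m • v + l • x = 0 → m = 0 ∧ l = 0)
    (hspan : ∀ w : Fin n → ℤ, ∃ g ∈ Submodule.span ℤ (faceMonoid P φ 𝔭 : Set (Fin n → ℤ)),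
      ∃ m l : ℤ, w = g + m • v + l • x)
    (h0 : maximalIdeal (Localization.AtPrime 𝔭) ≤
      (ideal P φ 𝔭).map (algebraMap A (Localization.AtPrime 𝔭)))
    (hdimA : ringKrullDim (Localization.AtPrime 𝔭) ≤ (2 : ℕ)) (hv : v ∈ Q)
    {𝔔 : Ideal (blowupAlgebra (Ideal.span ((fun q : Q => χ (Multiplicative.ofAdd q)) ''
        {q : Q | (q : Fin n → ℤ) = v ∨ (q : Fin n → ℤ) = x ∨ (q : Fin n → ℤ) = (c : ℤ) • v - x}))
        (χ (Multiplicative.ofAdd ⟨v, hv⟩)))} [𝔔.IsPrime]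
    (h𝔔 : 𝔔.comap (algebraMap A _) = 𝔭)
    (hq : ∀ q : blowupChartMonoid Q {q : Q | (q : Fin n → ℤ) = v ∨ (q : Fin n → ℤ) = x ∨
        (q : Fin n → ℤ) = (c : ℤ) • v - x} ⟨v, hv⟩,
      (q : Fin n → ℤ) ∉ Submodule.span ℤ (faceMonoid P φ 𝔭 : Set (Fin n → ℤ)) →
        blowupChart Q χ {q : Q | (q : Fin n → ℤ) = v ∨ (q : Fin n → ℤ) = x ∨ (q : Fin n → ℤ) = (c : ℤ) • v - x} ⟨v, hv⟩ (Multiplicative.ofAdd q) ∈ 𝔔) :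
    ¬ IsRegularLocalRing (Localization.AtPrime 𝔔) := by
  haveI : IsNoetherianRing (blowupAlgebra (Ideal.span ((fun q : Q => χ (Multiplicative.ofAdd q)) '' {q : Q | (q : Fin n → ℤ) = v ∨ (q : Fin n → ℤ) = x ∨ (q : Fin n → ℤ) = (c : ℤ) • v - x}))
      (χ (Multiplicative.ofAdd ⟨v, hv⟩))) :=
    isNoetherianRing_blowupAlgebra_of_isNoetherianRing _ _
  obtain ⟨hgen₂, hD₂, hK₂, hΩ₂⟩ := tower_pack hPQ hχ hgen hD hK hΩ
    {q : Q | (q : Fin n → ℤ) = v ∨ (q : Fin n → ℤ) = x ∨ (q : Fin n → ℤ) = (c : ℤ) • v - x} ⟨v, hv⟩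
  have hχ₂ := tower_chi hPQ hχ (le_blowupChartMonoid Q {q : Q | (q : Fin n → ℤ) = v ∨ (q : Fin n → ℤ) = x ∨ (q : Fin n → ℤ) = (c : ℤ) • v - x} ⟨v, hv⟩) (blowupChart_of_mem Q χ {q : Q | (q : Fin n → ℤ) = v ∨ (q : Fin n → ℤ) = x ∨ (q : Fin n → ℤ) = (c : ℤ) • v - x} ⟨v, hv⟩)
  have hQ₂ := mem_blowupChartMonoid_v_iff (by omega : 2 ≤ c) hQ hind hv
  have hind₂ := vertexBlowup_independent (L := Submodule.span ℤ (faceMonoid P φ 𝔭 : Set (Fin n → ℤ)))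
    hind
  have hspan₂ : ∀ w : Fin n → ℤ, ∃ g ∈ Submodule.span ℤ (faceMonoid P φ 𝔭 : Set (Fin n → ℤ)),
      ∃ m l : ℤ, w = g + m • v + l • (x - v) := by
    intro w
    obtain ⟨g, hg, m, l, rfl⟩ := hspan w
    exact ⟨g, hg, m + l, l, by module⟩
  have hfg₂ : (blowupChartMonoid Q {q : Q | (q : Fin n → ℤ) = v ∨ (q : Fin n → ℤ) = x ∨ (q : Fin n → ℤ) = (c : ℤ) • v - x} ⟨v, hv⟩).FG := blowupChartMonoid_fg hQfg three_finite ⟨v, hv⟩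
  exact not_isRegularLocalRing_fixedPrime_of_two_le (by omega : 2 ≤ c - 2) hP hsat hreg
    (hPQ.trans (le_blowupChartMonoid Q {q : Q | (q : Fin n → ℤ) = v ∨ (q : Fin n → ℤ) = x ∨ (q : Fin n → ℤ) = (c : ℤ) • v - x} ⟨v, hv⟩)) hχ₂ hgen₂ hD₂ hK₂ hfg₂ hQ₂ hind₂ hspan₂ h𝔔 hq h0 hdimA

/-- **For `c ∈ {2, 3}` the `v`-chart is regular at EVERY prime over `𝔭`**: its parameter `c − 2 ≤ 1`
makes it orthant-like (`…VertexChartSmallParameter`), so one blow-up resolves the fixed point.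
[cite: Kato1994, (10.1), (10.3)] -/
theorem isRegularLocalRing_vChart_of_le_three (hc : 2 ≤ c) (hc3 : c ≤ 3) (hP : P.FG)
    (hsat : ∀ (w : Fin n → ℤ) (k : ℕ), 0 < k → k • w ∈ P → w ∈ P)
    (hspanP : Submodule.span ℤ (P : Set (Fin n → ℤ)) = ⊤) (hPQ : P ≤ Q)
    (hχ : ∀ p : P, χ (Multiplicative.ofAdd ⟨(p : Fin n → ℤ), hPQ p.2⟩) =
      algebraMap A C (φ (Multiplicative.ofAdd p)))
    (hgen : Algebra.adjoin A (Set.range χ) = ⊤)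
    (hD : ∀ q ∈ Q, ∃ p ∈ P, q + p ∈ P)
    (hK : ∀ a : A, algebraMap A C a = 0 → ∃ p : P, φ (Multiplicative.ofAdd p) * a = 0)
    (hΩ : ∀ (K : Type u) [Field K] (g : A →+* K), (∀ p : P, g (φ (Multiplicative.ofAdd p)) ≠ 0) →
      ∃ ω : C →+* K, ω.comp (algebraMap A C) = g)
    (hQ : ∀ w, w ∈ Q ↔ ∃ g ∈ Submodule.span ℤ (faceMonoid P φ 𝔭 : Set (Fin n → ℤ)), ∃ m l : ℤ,
      0 ≤ m ∧ 0 ≤ m + (c : ℤ) * l ∧ w = g + m • v + l • x)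
    (hind : ∀ g ∈ Submodule.span ℤ (faceMonoid P φ 𝔭 : Set (Fin n → ℤ)), ∀ m l : ℤ,
      g + m • v + l • x = 0 → m = 0 ∧ l = 0)
    (hspan : ∀ w : Fin n → ℤ, ∃ g ∈ Submodule.span ℤ (faceMonoid P φ 𝔭 : Set (Fin n → ℤ)),
      ∃ m l : ℤ, w = g + m • v + l • x)
    (hreg : IsLogRegularAt P φ 𝔭) (hv : v ∈ Q)
    (𝔔 : Ideal (blowupAlgebra (Ideal.span ((fun q : Q => χ (Multiplicative.ofAdd q)) ''
        {q : Q | (q : Fin n → ℤ) = v ∨ (q : Fin n → ℤ) = x ∨ (q : Fin n → ℤ) = (c : ℤ) • v - x}))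
        (χ (Multiplicative.ofAdd ⟨v, hv⟩)))) [𝔔.IsPrime]
    (h𝔔 : 𝔔.comap (algebraMap A _) = 𝔭) :
    IsRegularLocalRing (Localization.AtPrime 𝔔) := by
  obtain ⟨hgen₂, -, -, hΩ₂⟩ := tower_pack hPQ hχ hgen hD hK hΩ
    {q : Q | (q : Fin n → ℤ) = v ∨ (q : Fin n → ℤ) = x ∨ (q : Fin n → ℤ) = (c : ℤ) • v - x} ⟨v, hv⟩
  have hχ₂ := tower_chi hPQ hχ (le_blowupChartMonoid Q {q : Q | (q : Fin n → ℤ) = v ∨ (q : Fin n → ℤ) = x ∨ (q : Fin n → ℤ) = (c : ℤ) • v - x} ⟨v, hv⟩) (blowupChart_of_mem Q χ {q : Q | (q : Fin n → ℤ) = v ∨ (q : Fin n → ℤ) = x ∨ (q : Fin n → ℤ) = (c : ℤ) • v - x} ⟨v, hv⟩)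
  have hQ₂ := mem_blowupChartMonoid_v_iff hc hQ hind hv
  have hind₂ := vertexBlowup_independent (L := Submodule.span ℤ (faceMonoid P φ 𝔭 : Set (Fin n → ℤ)))
    hind
  have hspan₂ : ∀ w : Fin n → ℤ, ∃ g ∈ Submodule.span ℤ (faceMonoid P φ 𝔭 : Set (Fin n → ℤ)),
      ∃ m l : ℤ, w = g + m • v + l • (x - v) := by
    intro w
    obtain ⟨g, hg, m, l, rfl⟩ := hspan w
    exact ⟨g, hg, m + l, l, by module⟩
  have hreg' : IsLogRegularAt P φ (𝔔.comap (algebraMap A _)) := by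
    have key : ∀ (𝔮 : Ideal A) [𝔮.IsPrime], 𝔮 = 𝔭 → IsLogRegularAt P φ 𝔮 := by
      intro 𝔮 _ h; subst h; exact hreg
    exact key _ h𝔔
  exact isRegularLocalRing_of_param_le_one (by omega : c - 2 ≤ 1) hP hsat hspanP
    (hPQ.trans (le_blowupChartMonoid Q {q : Q | (q : Fin n → ℤ) = v ∨ (q : Fin n → ℤ) = x ∨ (q : Fin n → ℤ) = (c : ℤ) • v - x} ⟨v, hv⟩)) hχ₂ hgen₂ hΩ₂ hQ₂ hind₂ hspan₂ 𝔔 hreg'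

end Summit.ResolutionOfSingularities.ResolutionOfSingularities.Theorems.FRationalResolution.VertexChartBlowupStep

end
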